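import Literature.MathematicalPhysics.QuantumFieldTheory.LatticeGaugePlaquetteLowerBound
import Literature.MathematicalPhysics.QuantumFieldTheory.StrongCouplingActivities
import Literature.MathematicalPhysics.QuantumLattice.SU2Haar
import Mathlib.LinearAlgebra.Matrix.Swap
import HarnessLib

/-!
# Robust ball (Y2), area-law side — the Haar second moments of `SU(N)` and the EXACT character variance
`V₀ = ∫ (Re tr U)² dU`

HONEST FRAMING: venture file of the cell `pub-ymgap` (QuantumFields programme), track ROBUST-BALL, seat rb-p2 (g5).  Pure
compact-group integration, nothing lattice-specific: for a compact group `G ≅ SU(N)` (`IsSpecialUnitaryModel ρ`, the tree's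
standing hypothesis for the gauge group) we compute the quadratic Haar moments of the matrix entries EXACTLY,
`∫ ρ(g)_{ai} conj(ρ(g)_{bk}) dg = δ_{ab} δ_{ik} / N` (`integral_entry_mul_conj_entry`) — the first Weingarten /
Schur-orthogonality relation of the fundamental representation — by nothing more than the two-sided invariance of the Haar
probability measure under three explicit special unitary matrices (a diagonal phase `diag(…, i, …, −i, …)` acting on the left
and on the right, and a signed transposition acting on the right) and the unitarity row sum `Σ_i |U_{ai}|² = 1`.
Consequences: `∫ |tr ρ(g)|² dg = 1` (`integral_normSq_trace`: the fundamental character has norm one), `∫ (tr ρ(g))² dg = 0`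
for `N ≥ 3` (centre twist by `e^{2πi/N}`, whose square is `≠ 1`), the trace of `SU(2)` is real, and therefore THE CHARACTER
VARIANCE OF THE TREE (`PlaquetteLowerBound.charVariance ρ = ∫ (Re tr ρ)² dHaar`, the constant `V₀` in the plaquette floor
`u₀ = β e^{−8(d−1)Nβ} V₀ / (2(d−1)N)` of `PlaquettePositivity` / `WilsonStringTension.stringTension_le`) IS
`V₀ = 1` for `N = 2` and `V₀ = 1/2` for `N ≥ 3` (`charVariance_eq_one`, `charVariance_eq_half`, `half_le_charVariance`);
previously the tree only knew `V₀ > 0` (`charVariance_pos`) and, for `SU(2)`, `V₀ ≥ 49/4096` (`charVariance_su2_ge`).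
WHAT IT IS NOT: no higher Weingarten calculus, no Peter–Weyl; nothing continuum / spectral / Clay.  Used by the sibling file
`StringTensionSharp` (sharp explicit string-tension ceilings for every `N`).

References: M. Creutz, *Quarks, gluons and lattices* (1983) §8 eq. (8.19)–(8.20) (`∫ dU U_{ij} U†_{kl} = δ_{il} δ_{jk}/n`);
B. Collins, IMRN 2003:17, 953 (Weingarten calculus, for context only); T. Bröcker, T. tom Dieck, GTM 98 (1985) II (4.11)
(Schur orthogonality).  Everything here is proved; no definition, no named fact. [folklore]
-/

noncomputable section

open MeasureTheory Complex ComplexConjugate Finset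
open Literature.MathematicalPhysics.QuantumLattice Literature.MathematicalPhysics.QuantumFieldTheory

namespace Summit.Ventures.YMGap.RobustBall

namespace HaarSecondMoments

/-! ### Three special unitary matrices -/

section Matrices

variable {N : ℕ}

/-- The diagonal phase matrix `diag(…, i (at a), …, −i (at b), …, 1 …)` lies in `SU(N)` (`a ≠ b`). [folklore] -/
theorem diagonal_phase_mem (a b : Fin N) (hab : a ≠ b) :
    Matrix.diagonal (Pi.mulSingle a Complex.I * Pi.mulSingle b (-Complex.I) : Fin N → ℂ) ∈
      Matrix.specialUnitaryGroup (Fin N) ℂ := by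
  rw [Matrix.mem_specialUnitaryGroup_iff]
  refine ⟨?_, ?_⟩
  · rw [Matrix.mem_unitaryGroup_iff, Matrix.star_eq_conjTranspose, Matrix.diagonal_conjTranspose,
      Matrix.diagonal_mul_diagonal, ← Matrix.diagonal_one]
    congr 1; funext j; simp only [Pi.mul_apply, Pi.star_apply]
    rcases eq_or_ne j a with rfl | hja
    · simp [Pi.mulSingle_eq_of_ne hab, Complex.conj_I]
    · rcases eq_or_ne j b with rfl | hjb
      · simp [Pi.mulSingle_eq_of_ne hja, Complex.conj_I]
      · simp [Pi.mulSingle_eq_of_ne hja, Pi.mulSingle_eq_of_ne hjb]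
  · rw [Matrix.det_diagonal]
    simp only [Pi.mul_apply]
    rw [Finset.prod_mul_distrib, Fintype.prod_pi_mulSingle', Fintype.prod_pi_mulSingle', mul_neg, Complex.I_mul_I,
      neg_neg]

/-- The signed transposition `swap(a,b) · diag(…, −1 (at a), …)` (a rotation by a right angle in the `(a,b)` coordinate
plane) lies in `SU(N)` (`a ≠ b`). [folklore] -/
theorem swap_mul_sign_mem (a b : Fin N) (hab : a ≠ b) :
    Matrix.swap ℂ a b * Matrix.diagonal (Pi.mulSingle a (-1 : ℂ)) ∈ Matrix.specialUnitaryGroup (Fin N) ℂ := by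
  rw [Matrix.mem_specialUnitaryGroup_iff]
  refine ⟨?_, ?_⟩
  · have h1 : Matrix.swap ℂ a b ∈ Matrix.unitaryGroup (Fin N) ℂ := by
      rw [Matrix.mem_unitaryGroup_iff, Matrix.star_eq_conjTranspose, Matrix.conjTranspose_swap,
        Matrix.swap_mul_self]
    have h2 : Matrix.diagonal (Pi.mulSingle a (-1 : ℂ)) ∈ Matrix.unitaryGroup (Fin N) ℂ := by
      rw [Matrix.mem_unitaryGroup_iff, Matrix.star_eq_conjTranspose, Matrix.diagonal_conjTranspose,
        Matrix.diagonal_mul_diagonal, ← Matrix.diagonal_one]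
      congr 1; funext j; simp only [Pi.star_apply]
      rcases eq_or_ne j a with rfl | hja
      · simp
      · simp [Pi.mulSingle_eq_of_ne hja]
    exact mul_mem h1 h2
  · rw [Matrix.det_mul, Matrix.swap, Matrix.det_permutation, Equiv.Perm.sign_swap hab, Matrix.det_diagonal,
      Fintype.prod_pi_mulSingle']
    simp

/-- The centre element `ζ • 1`, `ζ = e^{2πi/N}`, lies in `SU(N)` (`N ≠ 0`). [folklore] -/
theorem smul_one_mem (hN : N ≠ 0) :
    Complex.exp (2 * Real.pi * Complex.I / N) • (1 : Matrix (Fin N) (Fin N) ℂ) ∈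
      Matrix.specialUnitaryGroup (Fin N) ℂ := by
  set ζ : ℂ := Complex.exp (2 * Real.pi * Complex.I / N) with hζdef
  have hprim : IsPrimitiveRoot ζ N := Complex.isPrimitiveRoot_exp N hN
  have hζN : ζ ^ N = 1 := hprim.pow_eq_one
  have hnorm : ‖ζ‖ = 1 := hprim.norm'_eq_one hN
  have hconj : ζ * (starRingEnd ℂ) ζ = 1 := by
    rw [Complex.mul_conj, Complex.normSq_eq_norm_sq, hnorm]; simp
  rw [Matrix.mem_specialUnitaryGroup_iff]
  constructor
  · rw [Matrix.mem_unitaryGroup_iff, star_smul, star_one, smul_mul_assoc, one_mul, smul_smul,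
      Complex.star_def, hconj, one_smul]
  · rw [Matrix.det_smul, Matrix.det_one, mul_one, Fintype.card_fin, hζN]

end Matrices

/-! ### Haar invariance through the model `ρ : G ≅ SU(N)` -/

section Moments

variable {N : ℕ} {G : Type*} [Group G] [TopologicalSpace G] [IsTopologicalGroup G] [CompactSpace G]
  [MeasurableSpace G] [BorelSpace G] (ρ : G →* Matrix (Fin N) (Fin N) ℂ)

omit [IsTopologicalGroup G] [CompactSpace G] [MeasurableSpace G] [BorelSpace G] in
/-- Every special unitary matrix is a value of `ρ`. [folklore] -/
theorem exists_eq_of_mem (hρ : IsSpecialUnitaryModel ρ) {S : Matrix (Fin N) (Fin N) ℂ}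
    (hS : S ∈ Matrix.specialUnitaryGroup (Fin N) ℂ) : ∃ z : G, ρ z = S := by
  exact (show S ∈ Set.range ρ by rw [hρ.2.2]; exact hS)

/-- **Left invariance through the model**: `∫ F(S ρ(g)) dg = ∫ F(ρ(g)) dg` for every `S ∈ SU(N)`. [folklore] -/
theorem integral_comp_mul_left (hρ : IsSpecialUnitaryModel ρ) {S : Matrix (Fin N) (Fin N) ℂ}
    (hS : S ∈ Matrix.specialUnitaryGroup (Fin N) ℂ) {E : Type*} [NormedAddCommGroup E] [NormedSpace ℝ E]
    (F : Matrix (Fin N) (Fin N) ℂ → E) :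
    ∫ g, F (S * ρ g) ∂haarProbability G = ∫ g, F (ρ g) ∂haarProbability G := by
  obtain ⟨z, hz⟩ := exists_eq_of_mem ρ hρ hS
  simpa only [map_mul, hz] using integral_mul_left_eq_self (μ := haarProbability G) (fun g => F (ρ g)) z

/-- **Right invariance through the model**: `∫ F(ρ(g) S) dg = ∫ F(ρ(g)) dg` for every `S ∈ SU(N)` (compact groups are
unimodular, `haarProbability.instIsMulRightInvariant`). [folklore] -/
theorem integral_comp_mul_right (hρ : IsSpecialUnitaryModel ρ) {S : Matrix (Fin N) (Fin N) ℂ}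
    (hS : S ∈ Matrix.specialUnitaryGroup (Fin N) ℂ) {E : Type*} [NormedAddCommGroup E] [NormedSpace ℝ E]
    (F : Matrix (Fin N) (Fin N) ℂ → E) :
    ∫ g, F (ρ g * S) ∂haarProbability G = ∫ g, F (ρ g) ∂haarProbability G := by
  obtain ⟨z, hz⟩ := exists_eq_of_mem ρ hρ hS
  simpa only [map_mul, hz] using integral_mul_right_eq_self (μ := haarProbability G) (fun g => F (ρ g)) z

/-- Products of an entry and a conjugated entry of `ρ(g)` are Haar integrable (continuous on a compact group). [folklore] -/
theorem integrable_entry_mul_conj_entry (hρ : Continuous ρ) (a i b k : Fin N) :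
    Integrable (fun g => ρ g a i * (starRingEnd ℂ) (ρ g b k)) (haarProbability G) :=
  ((hρ.matrix_elem a i).mul (Complex.continuous_conj.comp (hρ.matrix_elem b k))).integrable_of_hasCompactSupport
    (HasCompactSupport.of_compactSpace _)

/-- A complex integral equal to its own negative vanishes. [folklore] -/
theorem integral_eq_zero_of_neg {f : G → ℂ}
    (h : ∫ g, -f g ∂haarProbability G = ∫ g, f g ∂haarProbability G) :
    ∫ g, f g ∂haarProbability G = 0 := by
  rw [integral_neg] at h
  exact add_self_eq_zero.mp (neg_eq_iff_add_eq_zero.mp h)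

/-! ### The quadratic moments of the entries -/

/-- **Different rows are orthogonal in mean**: `∫ ρ(g)_{ai} conj(ρ(g)_{bk}) dg = 0` for `a ≠ b` (left twist by the phase
`diag(i at a, −i at b)`: the integrand changes sign). [folklore] -/
theorem integral_entry_mul_conj_entry_eq_zero_of_row_ne (hρ : IsSpecialUnitaryModel ρ) {a b : Fin N}
    (hab : a ≠ b) (i k : Fin N) :
    ∫ g, ρ g a i * (starRingEnd ℂ) (ρ g b k) ∂haarProbability G = 0 := by
  set D := Matrix.diagonal (Pi.mulSingle a Complex.I * Pi.mulSingle b (-Complex.I) : Fin N → ℂ) with hD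
  have hDm : D ∈ Matrix.specialUnitaryGroup (Fin N) ℂ := by rw [hD]; exact diagonal_phase_mem a b hab
  have h := integral_comp_mul_left ρ hρ hDm (fun M => M a i * (starRingEnd ℂ) (M b k))
  have hDa : ∀ M : Matrix (Fin N) (Fin N) ℂ, (D * M) a i = Complex.I * M a i := fun M => by
    rw [hD, Matrix.diagonal_mul]; simp [Pi.mulSingle_eq_of_ne hab]
  have hDb : ∀ M : Matrix (Fin N) (Fin N) ℂ, (D * M) b k = -Complex.I * M b k := fun M => by
    rw [hD, Matrix.diagonal_mul]; simp [Pi.mulSingle_eq_of_ne hab.symm]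
  have hpt : ∀ M : Matrix (Fin N) (Fin N) ℂ,
      (D * M) a i * (starRingEnd ℂ) ((D * M) b k) = -(M a i * (starRingEnd ℂ) (M b k)) := fun M => by
    rw [hDa, hDb, map_mul, map_neg, Complex.conj_I, neg_neg]
    linear_combination (M a i * (starRingEnd ℂ) (M b k)) * Complex.I_mul_I
  simp only [hpt] at h
  exact integral_eq_zero_of_neg h

/-- **Different columns are orthogonal in mean**: `∫ ρ(g)_{ai} conj(ρ(g)_{ak}) dg = 0` for `i ≠ k` (right twist by the phase
`diag(i at i, −i at k)`). [folklore] -/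
theorem integral_entry_mul_conj_entry_eq_zero_of_col_ne (hρ : IsSpecialUnitaryModel ρ) (a : Fin N) {i k : Fin N}
    (hik : i ≠ k) :
    ∫ g, ρ g a i * (starRingEnd ℂ) (ρ g a k) ∂haarProbability G = 0 := by
  set D := Matrix.diagonal (Pi.mulSingle i Complex.I * Pi.mulSingle k (-Complex.I) : Fin N → ℂ) with hD
  have hDm : D ∈ Matrix.specialUnitaryGroup (Fin N) ℂ := by rw [hD]; exact diagonal_phase_mem i k hik
  have h := integral_comp_mul_right ρ hρ hDm (fun M => M a i * (starRingEnd ℂ) (M a k))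
  have hDi : ∀ M : Matrix (Fin N) (Fin N) ℂ, (M * D) a i = M a i * Complex.I := fun M => by
    rw [hD, Matrix.mul_diagonal]; simp [Pi.mulSingle_eq_of_ne hik]
  have hDk : ∀ M : Matrix (Fin N) (Fin N) ℂ, (M * D) a k = M a k * -Complex.I := fun M => by
    rw [hD, Matrix.mul_diagonal]; simp [Pi.mulSingle_eq_of_ne hik.symm]
  have hpt : ∀ M : Matrix (Fin N) (Fin N) ℂ,
      (M * D) a i * (starRingEnd ℂ) ((M * D) a k) = -(M a i * (starRingEnd ℂ) (M a k)) := fun M => by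
    rw [hDi, hDk, map_mul, map_neg, Complex.conj_I, neg_neg]
    linear_combination (M a i * (starRingEnd ℂ) (M a k)) * Complex.I_mul_I
  simp only [hpt] at h
  exact integral_eq_zero_of_neg h

/-- **The mean square modulus of an entry does not depend on the column** (right twist by a signed transposition). [folklore] -/
theorem integral_normSq_entry_eq_of_col (hρ : IsSpecialUnitaryModel ρ) (a i j : Fin N) :
    ∫ g, ρ g a i * (starRingEnd ℂ) (ρ g a i) ∂haarProbability G =
      ∫ g, ρ g a j * (starRingEnd ℂ) (ρ g a j) ∂haarProbability G := by
  rcases eq_or_ne i j with rfl | hij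
  · rfl
  set T := Matrix.swap ℂ i j * Matrix.diagonal (Pi.mulSingle i (-1 : ℂ)) with hT
  have hTm : T ∈ Matrix.specialUnitaryGroup (Fin N) ℂ := by rw [hT]; exact swap_mul_sign_mem i j hij
  have h := integral_comp_mul_right ρ hρ hTm (fun M => M a i * (starRingEnd ℂ) (M a i))
  have hTa : ∀ M : Matrix (Fin N) (Fin N) ℂ, (M * T) a i = -M a j := fun M => by
    rw [hT, ← Matrix.mul_assoc, Matrix.mul_diagonal, Matrix.mul_swap_apply_left]; simp
  have hpt : ∀ M : Matrix (Fin N) (Fin N) ℂ,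
      (M * T) a i * (starRingEnd ℂ) ((M * T) a i) = M a j * (starRingEnd ℂ) (M a j) := fun M => by
    rw [hTa, map_neg, neg_mul_neg]
  simp only [hpt] at h
  exact h.symm

/-- **Unitarity row sum in mean**: `Σ_i ∫ |ρ(g)_{ai}|² dg = 1`. [folklore] -/
theorem sum_integral_normSq_entry (hρ : IsSpecialUnitaryModel ρ) (a : Fin N) :
    ∑ i, ∫ g, ρ g a i * (starRingEnd ℂ) (ρ g a i) ∂haarProbability G = 1 := by
  rw [← integral_finsetSum _ (fun i _ => integrable_entry_mul_conj_entry ρ hρ.1 a i a i)]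
  have hrow : ∀ g : G, ∑ i, ρ g a i * (starRingEnd ℂ) (ρ g a i) = 1 := by
    intro g
    have hu := IsSpecialUnitaryModel.mem_unitaryGroup ρ hρ g
    rw [Matrix.mem_unitaryGroup_iff] at hu
    have h := congrFun (congrFun hu a) a
    rw [Matrix.mul_apply, Matrix.one_apply_eq] at h
    simpa [Matrix.star_apply, Complex.star_def] using h
  simp_rw [hrow]
  simp

/-- **`∫ |ρ(g)_{ai}|² dg = 1/N`** for every entry. [folklore] -/
theorem integral_normSq_entry (hρ : IsSpecialUnitaryModel ρ) (a i : Fin N) :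
    ∫ g, ρ g a i * (starRingEnd ℂ) (ρ g a i) ∂haarProbability G = (N : ℂ)⁻¹ := by
  have h1 := sum_integral_normSq_entry ρ hρ a
  have h2 : ∑ j : Fin N, ∫ g, ρ g a j * (starRingEnd ℂ) (ρ g a j) ∂haarProbability G =
      ∑ _j : Fin N, ∫ g, ρ g a i * (starRingEnd ℂ) (ρ g a i) ∂haarProbability G :=
    Finset.sum_congr rfl fun j _ => (integral_normSq_entry_eq_of_col ρ hρ a i j).symm
  rw [h2, Finset.sum_const, Finset.card_univ, Fintype.card_fin, nsmul_eq_mul] at h1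
  exact eq_inv_of_mul_eq_one_right h1

/-- ★ **THE QUADRATIC HAAR MOMENTS OF `SU(N)`** (first Weingarten / Schur-orthogonality relation of the fundamental
representation): `∫ ρ(g)_{ai} conj(ρ(g)_{bk}) dg = δ_{ab} δ_{ik} / N` for a compact group `G ≅ SU(N)`
(Creutz (8.20)). [folklore] -/
theorem integral_entry_mul_conj_entry (hρ : IsSpecialUnitaryModel ρ) (a i b k : Fin N) :
    ∫ g, ρ g a i * (starRingEnd ℂ) (ρ g b k) ∂haarProbability G =
      if a = b ∧ i = k then (N : ℂ)⁻¹ else 0 := by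
  split_ifs with h
  · obtain ⟨rfl, rfl⟩ := h
    exact integral_normSq_entry ρ hρ a i
  · rcases ne_or_eq a b with hab | rfl
    · exact integral_entry_mul_conj_entry_eq_zero_of_row_ne ρ hρ hab i k
    · have hik : i ≠ k := fun hik => h ⟨rfl, hik⟩
      exact integral_entry_mul_conj_entry_eq_zero_of_col_ne ρ hρ a hik

/-! ### The quadratic moments of the character -/

/-- **The fundamental character has mean square modulus one**: `∫ tr ρ(g) · conj(tr ρ(g)) dg = 1` (`N ≥ 1`). [folklore] -/
theorem integral_trace_mul_conj_trace (hρ : IsSpecialUnitaryModel ρ) (hN : 1 ≤ N) :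
    ∫ g, (ρ g).trace * (starRingEnd ℂ) (ρ g).trace ∂haarProbability G = 1 := by
  have hexp : ∀ g : G, (ρ g).trace * (starRingEnd ℂ) (ρ g).trace =
      ∑ a, ∑ b, ρ g a a * (starRingEnd ℂ) (ρ g b b) := by
    intro g
    simp only [Matrix.trace, Matrix.diag_apply, map_sum, Finset.sum_mul_sum]
  simp_rw [hexp]
  rw [integral_finsetSum _ (fun a _ =>
    integrable_finsetSum _ (fun b _ => integrable_entry_mul_conj_entry ρ hρ.1 a a b b))]
  have hin : ∀ a : Fin N, ∫ g, ∑ b, ρ g a a * (starRingEnd ℂ) (ρ g b b) ∂haarProbability G = (N : ℂ)⁻¹ := by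
    intro a
    rw [integral_finsetSum _ (fun b _ => integrable_entry_mul_conj_entry ρ hρ.1 a a b b)]
    simp_rw [integral_entry_mul_conj_entry ρ hρ, and_self]
    rw [Finset.sum_ite_eq]
    simp
  simp_rw [hin]
  rw [Finset.sum_const, Finset.card_univ, Fintype.card_fin, nsmul_eq_mul]
  have hN0 : (N : ℂ) ≠ 0 := by exact_mod_cast (show N ≠ 0 by omega)
  exact mul_inv_cancel₀ hN0

/-- **`∫ |tr ρ(g)|² dg = 1`** (real form, `Complex.normSq`). [folklore] -/
theorem integral_normSq_trace (hρ : IsSpecialUnitaryModel ρ) (hN : 1 ≤ N) :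
    ∫ g, Complex.normSq (ρ g).trace ∂haarProbability G = 1 := by
  have h := integral_trace_mul_conj_trace ρ hρ hN
  simp_rw [Complex.mul_conj] at h
  rw [integral_complex_ofReal] at h
  exact_mod_cast h

/-- **`∫ (tr ρ(g))² dg = 0` for `N ≥ 3`** (centre twist: `tr ρ(zg) = ζ tr ρ(g)` with `ζ = e^{2πi/N}`, and `ζ² ≠ 1` because
`N ∤ 2`). [folklore] -/
theorem integral_trace_sq_eq_zero (hρ : IsSpecialUnitaryModel ρ) (hN : 3 ≤ N) :
    ∫ g, (ρ g).trace ^ 2 ∂haarProbability G = 0 := by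
  set ζ : ℂ := Complex.exp (2 * Real.pi * Complex.I / N) with hζdef
  have hN0 : N ≠ 0 := by omega
  have hprim : IsPrimitiveRoot ζ N := Complex.isPrimitiveRoot_exp N hN0
  have hζ2 : ζ ^ 2 ≠ 1 := fun h => by
    have := Nat.le_of_dvd two_pos ((hprim.pow_eq_one_iff_dvd 2).mp h); omega
  have hmem : ζ • (1 : Matrix (Fin N) (Fin N) ℂ) ∈ Matrix.specialUnitaryGroup (Fin N) ℂ := by
    rw [hζdef]; exact smul_one_mem (N := N) hN0
  have h := integral_comp_mul_left ρ hρ hmem (fun M => M.trace ^ 2)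
  have ht : ∀ M : Matrix (Fin N) (Fin N) ℂ, (ζ • (1 : Matrix (Fin N) (Fin N) ℂ) * M).trace ^ 2 =
      ζ ^ 2 * M.trace ^ 2 := fun M => by rw [smul_mul_assoc, one_mul, Matrix.trace_smul, smul_eq_mul, mul_pow]
  simp only [ht] at h
  rw [integral_const_mul] at h
  set J : ℂ := ∫ g, (ρ g).trace ^ 2 ∂haarProbability G
  have h2 : (ζ ^ 2 - 1) * J = 0 := by rw [sub_mul, one_mul, h, sub_self]
  rcases mul_eq_zero.mp h2 with h' | h'
  · exact absurd (sub_eq_zero.mp h') hζ2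
  · exact h'

/-- **The trace of `SU(2)` is real**: `conj(tr ρ(g)) = tr ρ(g)` for `G ≅ SU(2)` (`U₁₁ = conj U₀₀`). [folklore] -/
theorem conj_trace_eq_of_two {G : Type*} [Group G] [TopologicalSpace G] (ρ : G →* Matrix (Fin 2) (Fin 2) ℂ)
    (hρ : IsSpecialUnitaryModel ρ) (g : G) : (starRingEnd ℂ) (ρ g).trace = (ρ g).trace := by
  have hmem : ρ g ∈ (Matrix.specialUnitaryGroup (Fin 2) ℂ : Set (Matrix (Fin 2) (Fin 2) ℂ)) :=
    hρ.2.2 ▸ Set.mem_range_self g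
  have h11 := su2_apply_11 ⟨ρ g, hmem⟩
  change ρ g 1 1 = (starRingEnd ℂ) (ρ g 0 0) at h11
  rw [Matrix.trace_fin_two, h11, map_add, Complex.conj_conj, add_comm]

/-- **`∫ (tr ρ(g))² dg = 1` for `G ≅ SU(2)`** (the trace is real, so this is `∫ |tr|² = 1`). [folklore] -/
theorem integral_trace_sq_eq_one_of_two {G : Type*} [Group G] [TopologicalSpace G] [IsTopologicalGroup G]
    [CompactSpace G] [MeasurableSpace G] [BorelSpace G] (ρ : G →* Matrix (Fin 2) (Fin 2) ℂ)
    (hρ : IsSpecialUnitaryModel ρ) : ∫ g, (ρ g).trace ^ 2 ∂haarProbability G = 1 := by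
  have h := integral_trace_mul_conj_trace ρ hρ (by norm_num)
  simp_rw [conj_trace_eq_of_two ρ hρ, ← pow_two] at h
  exact h

/-! ### The exact character variance `V₀` -/

/-- The pointwise identity `(Re z)² = (|z|² + Re(z²)) / 2`. [folklore] -/
theorem re_sq_eq (z : ℂ) : z.re ^ 2 = (Complex.normSq z + (z ^ 2).re) / 2 := by
  rw [Complex.normSq_apply]
  simp only [pow_two, Complex.mul_re]
  ring

/-- **`V₀ = (1 + Re ∫ (tr ρ)²)/2`** for `G ≅ SU(N)`, `N ≥ 1`. [folklore] -/
theorem charVariance_eq_half_add (hρ : IsSpecialUnitaryModel ρ) (hN : 1 ≤ N) :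
    PlaquetteLowerBound.charVariance ρ = (1 + (∫ g, (ρ g).trace ^ 2 ∂haarProbability G).re) / 2 := by
  unfold PlaquetteLowerBound.charVariance PlaquetteLowerBound.reTr
  simp_rw [re_sq_eq]
  have hc : Continuous fun g : G => (ρ g).trace := hρ.1.matrix_trace
  have hi1 : Integrable (fun g : G => Complex.normSq (ρ g).trace) (haarProbability G) :=
    (Complex.continuous_normSq.comp hc).integrable_of_hasCompactSupport (HasCompactSupport.of_compactSpace _)
  have hi2c : Integrable (fun g : G => (ρ g).trace ^ 2) (haarProbability G) :=
    (hc.pow 2).integrable_of_hasCompactSupport (HasCompactSupport.of_compactSpace _)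
  have hi2 : Integrable (fun g : G => ((ρ g).trace ^ 2).re) (haarProbability G) := hi2c.re
  rw [integral_div, integral_add hi1 hi2, integral_normSq_trace ρ hρ hN]
  congr 2
  simpa using integral_re hi2c

/-- ★★ **`V₀(SU(2)) = 1` EXACTLY**: `∫ (Re tr ρ(g))² dg = 1` for every compact group `G ≅ SU(2)`. [folklore] -/
theorem charVariance_eq_one {G : Type*} [Group G] [TopologicalSpace G] [IsTopologicalGroup G]
    [CompactSpace G] [MeasurableSpace G] [BorelSpace G] (ρ : G →* Matrix (Fin 2) (Fin 2) ℂ)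
    (hρ : IsSpecialUnitaryModel ρ) : PlaquetteLowerBound.charVariance ρ = 1 := by
  rw [charVariance_eq_half_add ρ hρ (by norm_num), integral_trace_sq_eq_one_of_two ρ hρ, Complex.one_re]
  norm_num

/-- ★★ **`V₀(SU(N)) = 1/2` EXACTLY for `N ≥ 3`**: `∫ (Re tr ρ(g))² dg = 1/2` for every compact group `G ≅ SU(N)`. [folklore] -/
theorem charVariance_eq_half (hρ : IsSpecialUnitaryModel ρ) (hN : 3 ≤ N) :
    PlaquetteLowerBound.charVariance ρ = 1 / 2 := by
  rw [charVariance_eq_half_add ρ hρ (by omega), integral_trace_sq_eq_zero ρ hρ hN, Complex.zero_re]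
  norm_num

/-- ★ **`V₀ ≥ 1/2` for every `G ≅ SU(N)`, `N ≥ 2`** (`= 1` for `N = 2`, `= 1/2` for `N ≥ 3`). [folklore] -/
theorem half_le_charVariance (hρ : IsSpecialUnitaryModel ρ) (hN : 2 ≤ N) :
    1 / 2 ≤ PlaquetteLowerBound.charVariance ρ := by
  rcases Nat.lt_or_ge N 3 with h3 | h3
  · obtain rfl : N = 2 := by omega
    rw [charVariance_eq_one ρ hρ]
    norm_num
  · rw [charVariance_eq_half ρ hρ h3]

/-- **`V₀ ≤ 1` for every `G ≅ SU(N)`, `N ≥ 2`.** [folklore] -/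
theorem charVariance_le_one (hρ : IsSpecialUnitaryModel ρ) (hN : 2 ≤ N) :
    PlaquetteLowerBound.charVariance ρ ≤ 1 := by
  rcases Nat.lt_or_ge N 3 with h3 | h3
  · obtain rfl : N = 2 := by omega
    rw [charVariance_eq_one ρ hρ]
  · rw [charVariance_eq_half ρ hρ h3]
    norm_num

end Moments

/-! ### The concrete groups `SU(N) = Matrix.specialUnitaryGroup (Fin N) ℂ` -/

/-- ★★ **`∫_{SU(2)} (Re tr U)² dU = 1`** in the venture's vocabulary (`fundamentalRep (Fin 2)`): the constant `V₀` of the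
cell's string-tension ceilings is `1`, not merely `≥ 49/4096`. [folklore] -/
theorem charVariance_su2 : PlaquetteLowerBound.charVariance (fundamentalRep (Fin 2)) = 1 :=
  charVariance_eq_one (fundamentalRep (Fin 2)) (TorusAreaLaw.isSpecialUnitaryModel_fundamentalRep 2)

/-- ★★ **`∫_{SU(N)} (Re tr U)² dU = 1/2` for `N ≥ 3`.** [folklore] -/
theorem charVariance_suN {N : ℕ} (hN : 3 ≤ N) : PlaquetteLowerBound.charVariance (fundamentalRep (Fin N)) = 1 / 2 :=
  charVariance_eq_half (fundamentalRep (Fin N)) (TorusAreaLaw.isSpecialUnitaryModel_fundamentalRep N) hN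

/-- **`∫_{SU(N)} |tr U|² dU = 1`** (`N ≥ 1`). [folklore] -/
theorem integral_normSq_trace_suN {N : ℕ} (hN : 1 ≤ N) :
    ∫ U, Complex.normSq (U : Matrix (Fin N) (Fin N) ℂ).trace ∂haarProbability (Matrix.specialUnitaryGroup (Fin N) ℂ) = 1 := by
  have h := integral_normSq_trace (fundamentalRep (Fin N)) (TorusAreaLaw.isSpecialUnitaryModel_fundamentalRep N) hN
  simpa only [fundamentalRep_apply] using h

/-- **`∫_{SU(N)} U_{ai} conj(U_{bk}) dU = δ_{ab} δ_{ik}/N`** (Creutz (8.20)). [folklore] -/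
theorem integral_entry_mul_conj_entry_suN {N : ℕ} (a i b k : Fin N) :
    ∫ U, (U : Matrix (Fin N) (Fin N) ℂ) a i * (starRingEnd ℂ) ((U : Matrix (Fin N) (Fin N) ℂ) b k)
        ∂haarProbability (Matrix.specialUnitaryGroup (Fin N) ℂ) = if a = b ∧ i = k then (N : ℂ)⁻¹ else 0 := by
  have h := integral_entry_mul_conj_entry (fundamentalRep (Fin N))
    (TorusAreaLaw.isSpecialUnitaryModel_fundamentalRep N) a i b k
  simpa only [fundamentalRep_apply] using h

end HaarSecondMoments

end Summit.Ventures.YMGap.RobustBall
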